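import Summits.RiemannHypothesis.RiemannHypothesis.Theorems.GroundBartaEvenWinsBeyondArchDeflationResidualLoc
import Literature.Analysis.ValidatedNumerics.TaylorModelEdgePanel
import Literature.Analysis.ValidatedNumerics.TaylorModelLogEdge
import Literature.NumberTheory.LFunctions.WeilArchTailRegTM
import HarnessLib

/-!
# RiemannHypothesis / GroundBarta — rung 4 (`EvenWinsBeyondArch`, stmt-RiemannHypothesis-18807 / 18085):
# the deflated Temple L-side, XVII c′ — the EDGE panel from local tables (kernel-feasible v2)

Helper file (`--supports stmt-RiemannHypothesis-18807`), RH-free, Mathlib + landed tree files only, no facts.  Prover B,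
speedrun unit `sr-gb-rung-b` (gen 4).  On the last y-panel `k = m − 1` (`y_k = c − h`) the archimedean integrals start/end
inside t-panel `0`: `E(ρ) = ∫_0^{h−ρ} G·Δ²/t` and the panel-0 piece `∫_{h−ρ}^{2h} G·Δ¹/t` of `H` are weighted sums of the
MOVING moments `∫_0^{h−ρ} G t^j dt` (`TaylorModelEdgePanel.tmem_wmom`, `partPolyI`), the other panels of `H` as in file XVI′.
With these, `dt_residualEdgeLocTM` encloses the regular part `T` of the flagged residual (`g(y)Ψ(c−y)` replaced by
`g(y)Ψ̃♮(c−y)`, `WeilArchTailRegTM`), and `dt_residualEdgeL_split` is the log split `R♭(c−s) = −½ g(c−s) log s + T(h−s)`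
consumed by `TaylorModelLogEdge.integral_sq_logEdge_le` (whose exact moments of `q = Poly.shift g c` ARE kernel-cheap, ≈ 3 s).

References: E. Bombieri, Rend. Mat. Acc. Lincei (9) 11 (2000) Thm 2 [Bombieri2000Weil]; K. Makino, M. Berz (2003).

-/

set_option linter.dupNamespace false

noncomputable section

open MeasureTheory Set Filter intervalIntegral
open scoped Topology BigOperators

namespace Summit.RiemannHypothesis.RiemannHypothesis.Theorems.EvenWinsBeyondArch

open Literature.NumberTheory.LFunctions
open Literature.Analysis.ValidatedNumerics Literature.Analysis.ValidatedNumerics.PolyMP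
  Literature.Analysis.ValidatedNumerics.NumericsMP Literature.Analysis.ValidatedNumerics.ExpPoly

/-! ## Moving moments on t-panel 0 -/

section EdgeArch

variable {S : ℕ} {c : ℚ} {m Dl : ℕ} {g : ℝ → ℝ}

/-- `(a + u)^j` as an exact polynomial in `u` (binomial expansion; cheap in the kernel). -/
def dt_shiftMono (a : ℚ) (j : ℕ) : Poly := (List.range (j + 1)).map fun k ↦ (j.choose k : ℚ) * a ^ (j - k)

/-- `eval (dt_shiftMono a j) u = (a + u)^j`. -/
theorem dt_eval_shiftMono (a : ℚ) (j : ℕ) (u : ℝ) : Poly.eval (dt_shiftMono a j) u = ((a : ℝ) + u) ^ j := by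
  rw [Poly.eval_eq_evalR, dt_shiftMono, List.map_map]
  have := evalR_map_range (fun k ↦ (((j.choose k : ℚ) * a ^ (j - k) : ℚ) : ℝ)) u (j + 1)
  rw [show (List.range (j + 1)).map (((↑) : ℚ → ℝ) ∘ fun k ↦ (j.choose k : ℚ) * a ^ (j - k)) =
      (List.range (j + 1)).map (fun k ↦ (((j.choose k : ℚ) * a ^ (j - k) : ℚ) : ℝ)) from rfl, this, add_comm (a : ℝ), add_pow]
  refine Finset.sum_congr rfl fun k _ ↦ ?_
  push_cast
  ring

/-- Moving moments `ρ ↦ ∫_0^{h−ρ} G t^j dt = ∫_{-h}^{-ρ} G(h+u)(h+u)^j du` from the panel-0 model `(W0, pw0)` of `u ↦ G(h+u)`. -/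
def dt_movMomTM (S : ℕ) (h : ℚ) (W0 : IPoly) (pw0 : Poly) (j : ℕ) : IPoly :=
  partPolyI S h W0 pw0 (dt_shiftMono h j) (-1)

/-- [folklore] -/
theorem dt_tmem_movMom (hS : 0 < S) (hc : 0 < c) (hm : 0 < m) {W0 : IPoly}
    (hW0 : TMem S (c / (2 * m)) (fun u ↦ weilArchDensityG (((PolyMP.panelCentre (c / (2 * m)) 0 : ℚ) : ℝ) + u)) W0)
    (pw0 : Poly) (j : ℕ) :
    TMem S (c / (2 * m)) (fun ρ ↦ ∫ t in (0 : ℝ)..(((c / (2 * m) : ℚ) : ℝ) - ρ), weilArchDensityG t * t ^ j)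
      (dt_movMomTM S (c / (2 * m)) W0 pw0 j) := by
  set h : ℚ := c / (2 * m) with hh
  have hmq : (0 : ℚ) < m := by exact_mod_cast hm
  have hh0 : 0 ≤ h := by rw [hh]; positivity
  have hhr : (0 : ℝ) ≤ h := by exact_mod_cast hh0
  have h0c : ((PolyMP.panelCentre h 0 : ℚ) : ℝ) = (h : ℝ) := by simp [PolyMP.panelCentre]
  have hGi : IntervalIntegrable (fun u ↦ weilArchDensityG (((PolyMP.panelCentre h 0 : ℚ) : ℝ) + u)) volume (-(h : ℝ)) h := by
    rw [h0c]
    have := (intervalIntegrable_weilArchDensityG (a := 0) (b := 2 * (h : ℝ)) le_rfl (by linarith)).comp_add_left (h : ℝ)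
    convert this using 2 <;> ring
  have hT := tmem_partPoly hS hh0 hGi hW0 pw0 (dt_shiftMono h j) (τ := -1) (Or.inr rfl)
  refine tmem_congr_on hT fun ρ _ ↦ ?_
  simp_rw [dt_eval_shiftMono, h0c]
  have hcv := intervalIntegral.integral_comp_add_left (fun t ↦ weilArchDensityG t * t ^ j) (h : ℝ)
    (a := -(h : ℝ)) (b := (((-1 : ℤ) : ℝ)) * ρ)
  rw [hcv]
  congr 1
  · ring
  · push_cast; ring

/-- The symmetric second-difference weights `κ_b = −2` (`b ≥ 2` even). -/
def dt_kappaE (b : ℕ) : ℤ := if b = 0 ∨ b % 2 = 1 then 0 else -2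

/-- `E` on the edge panel expanded: `∫_{(0, c−y]} G·Δ²/t = Σ_p Σ_b ρ^p a C κ_b ∫_0^{h−ρ} G t^{b−1}` (`y = y₀ + ρ`, `|ρ| ≤ h`). -/
theorem dt_archEEdge_expand (hc : 0 < c) (hm : 0 < m) {as0 : List ℝ}
    (hexp0 : ∀ s, g (((PolyMP.panelCentre (c / (2 * m)) (m - 1) : ℚ) : ℝ) + s) = evalR as0 s) {ρ : ℝ}
    (hρ : |ρ| ≤ ((c / (2 * m) : ℚ) : ℝ)) :
    ∫ t in Ioc 0 ((c : ℝ) - ((((PolyMP.panelCentre (c / (2 * m)) (m - 1) : ℚ) : ℝ) + ρ))),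
        weilArchDensityG t * ((2 * g (((PolyMP.panelCentre (c / (2 * m)) (m - 1) : ℚ) : ℝ) + ρ) -
          g (((PolyMP.panelCentre (c / (2 * m)) (m - 1) : ℚ) : ℝ) + ρ - t) -
          g (((PolyMP.panelCentre (c / (2 * m)) (m - 1) : ℚ) : ℝ) + ρ + t)) / t) =
      ∑ p ∈ Finset.range as0.length, ∑ b ∈ Finset.range (as0.length - p),
        ρ ^ p * (as0.getD (p + b) 0 * ((p + b).choose p : ℝ)) *
          ((dt_kappaE b : ℝ) * ∫ t in (0 : ℝ)..(((c / (2 * m) : ℚ) : ℝ) - ρ), weilArchDensityG t * t ^ (b - 1)) := by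
  set h : ℚ := c / (2 * m) with hh
  have hmq : (0 : ℚ) < m := by exact_mod_cast hm
  have hh0 : 0 ≤ h := by rw [hh]; positivity
  set y0 : ℝ := ((PolyMP.panelCentre h (m - 1) : ℚ) : ℝ) with hy0
  have hcy : (c : ℝ) - y0 = h := by
    rw [hy0]; have := dt_c_sub_y0 (c := c) (k := m - 1) (by omega : m - 1 < m)
    rw [show m - 1 - (m - 1) = 0 by omega] at this
    rw [this, dt_tI_eq, hh]; push_cast; ring
  have hρ2 := (abs_le.1 hρ).2
  rw [show (c : ℝ) - (y0 + ρ) = (h : ℝ) - ρ by rw [← hcy]; ring, ← intervalIntegral.integral_of_le (by linarith)]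
  have hGi : IntervalIntegrable weilArchDensityG volume (0 : ℝ) ((h : ℝ) - ρ) :=
    intervalIntegrable_weilArchDensityG le_rfl (by linarith)
  have step1 : ∫ t in (0 : ℝ)..((h : ℝ) - ρ), weilArchDensityG t * ((2 * g (y0 + ρ) - g (y0 + ρ - t) - g (y0 + ρ + t)) / t) =
      ∫ t in (0 : ℝ)..((h : ℝ) - ρ), ∑ p ∈ Finset.range as0.length, ∑ b ∈ Finset.range (as0.length - p),
        ρ ^ p * (as0.getD (p + b) 0 * ((p + b).choose p : ℝ)) *
          ((dt_kappaE b : ℝ) * (weilArchDensityG t * t ^ (b - 1))) := by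
    refine intervalIntegral.integral_congr fun t _ ↦ ?_
    rw [mul_comm (weilArchDensityG t), symmDiff_div_eq_sum hexp0 ρ t, Finset.sum_mul]
    refine Finset.sum_congr rfl fun p _ ↦ ?_
    rw [Finset.sum_mul]
    refine Finset.sum_congr rfl fun b _ ↦ ?_
    by_cases hb : b = 0 ∨ b % 2 = 1
    · simp [hb, dt_kappaE]
    · simp only [hb, if_false, dt_kappaE]; push_cast; ring
  have hterm : ∀ p b : ℕ, IntervalIntegrable (fun t ↦ ρ ^ p * (as0.getD (p + b) 0 * ((p + b).choose p : ℝ)) *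
      ((dt_kappaE b : ℝ) * (weilArchDensityG t * t ^ (b - 1)))) volume (0 : ℝ) ((h : ℝ) - ρ) :=
    fun p b ↦ ((hGi.mul_continuousOn (continuous_pow _).continuousOn).const_mul _).const_mul _
  have hinner : ∀ p : ℕ, IntervalIntegrable (fun t ↦ ∑ b ∈ Finset.range (as0.length - p),
      ρ ^ p * (as0.getD (p + b) 0 * ((p + b).choose p : ℝ)) *
        ((dt_kappaE b : ℝ) * (weilArchDensityG t * t ^ (b - 1)))) volume (0 : ℝ) ((h : ℝ) - ρ) := by
    intro p
    have := IntervalIntegrable.sum (Finset.range (as0.length - p)) (μ := volume) (a := (0 : ℝ)) (b := (h : ℝ) - ρ)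
      (fun b _ ↦ hterm p b)
    refine this.congr fun t _ ↦ ?_
    simp only [Finset.sum_apply]
  rw [step1, intervalIntegral.integral_finsetSum (fun p _ ↦ hinner p)]
  refine Finset.sum_congr rfl fun p _ ↦ ?_
  rw [intervalIntegral.integral_finsetSum (fun b _ ↦ hterm p b)]
  refine Finset.sum_congr rfl fun b _ ↦ ?_
  rw [intervalIntegral.integral_const_mul, intervalIntegral.integral_const_mul]

/-- The moving moments lie in `[0, M̄_j/S]` where `M̄_j` is the upper end of the full-panel G-moment enclosure. -/
theorem dt_movMom_bounds (hS : 0 < S) (hc : 0 < c) (hm : 0 < m) {M0 : List MI}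
    (hM0 : ∀ j, j < M0.length →
      MI.mem S (∫ t in (0 : ℝ)..(2 * ((c / (2 * m) : ℚ) : ℝ)), weilArchDensityG t * t ^ j) (M0.getD j default))
    {n : ℕ} (hlenM : n ≤ M0.length + 1) {ρ : ℝ} (hρ : |ρ| ≤ ((c / (2 * m) : ℚ) : ℝ)) :
    ∀ j, j + 1 < n → 0 ≤ (∫ t in (0 : ℝ)..(((c / (2 * m) : ℚ) : ℝ) - ρ), weilArchDensityG t * t ^ j) ∧
      (∫ t in (0 : ℝ)..(((c / (2 * m) : ℚ) : ℝ) - ρ), weilArchDensityG t * t ^ j) ≤ (((M0.getD j default).hi : ℤ) : ℝ) / S := by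
  intro j hj
  set h : ℚ := c / (2 * m) with hh
  have hhr : (0 : ℝ) < h := dt_h_pos hc hm
  have hρ1 := (abs_le.1 hρ).1
  have hρ2 := (abs_le.1 hρ).2
  have hnn : ∀ t ∈ Icc (0 : ℝ) (2 * h), 0 ≤ weilArchDensityG t * t ^ j := fun t ht ↦
    mul_nonneg (weilArchDensityG_nonneg ht.1) (pow_nonneg ht.1 _)
  have hint : IntervalIntegrable (fun t ↦ weilArchDensityG t * t ^ j) volume (0 : ℝ) (2 * h) :=
    (intervalIntegrable_weilArchDensityG le_rfl (by positivity)).mul_continuousOn (continuous_pow _).continuousOn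
  have h1 : 0 ≤ ∫ t in (0 : ℝ)..((h : ℝ) - ρ), weilArchDensityG t * t ^ j :=
    intervalIntegral.integral_nonneg (by linarith) fun t ht ↦ hnn t ⟨ht.1, by linarith [ht.2]⟩
  have h2 : (∫ t in (0 : ℝ)..((h : ℝ) - ρ), weilArchDensityG t * t ^ j) ≤
      ∫ t in (0 : ℝ)..(2 * (h : ℝ)), weilArchDensityG t * t ^ j := by
    refine intervalIntegral.integral_mono_interval le_rfl (by linarith) (by linarith) ?_ hint
    rw [Filter.EventuallyLE, MeasureTheory.ae_restrict_iff' measurableSet_Ioc]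
    exact Filter.Eventually.of_forall fun t ht ↦ hnn t ⟨ht.1.le, ht.2⟩
  have h3 := (hM0 j (by omega)).2
  have hSr : (0 : ℝ) < S := by exact_mod_cast hS
  refine ⟨h1, h2.trans ?_⟩
  rw [le_div_iff₀ hSr]
  exact h3

/-- The E-part on the edge panel (monolithic form; the kernel uses the chunked form below). -/
def dt_archEEdgeTM (S : ℕ) (c : ℚ) (m Dl : ℕ) (A0 : IPoly) (W0 : IPoly) (pw0 : Poly) : IPoly :=
  wmomTM S (c / (2 * m)) Dl A0 dt_kappaE (fun j ↦ dt_movMomTM S (c / (2 * m)) W0 pw0 j)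

/-- **E on the edge panel** (`y₀ = c − h`): `ρ ↦ ∫_{(0, c−y]} G·Δ²/t` enclosed from the exact local expansion `as ∈ A0`
of `g` at `y₀` and the panel-0 model of `G`. [cite: Bombieri2000Weil, Thm 2 (archimedean term)] -/
theorem dt_tmem_archEEdge (hS : 0 < S) (hc : 0 < c) (hm : 0 < m) (Dl : ℕ)
    {as0 : List ℝ} {A0 : IPoly} (has0 : PMem S as0 A0)
    (hexp0 : ∀ s, g (((PolyMP.panelCentre (c / (2 * m)) (m - 1) : ℚ) : ℝ) + s) = evalR as0 s)
    {W0 : IPoly} (hW0 : TMem S (c / (2 * m)) (fun u ↦ weilArchDensityG (((PolyMP.panelCentre (c / (2 * m)) 0 : ℚ) : ℝ) + u)) W0)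
    (pw0 : Poly) :
    TMem S (c / (2 * m)) (fun ρ ↦ ∫ t in Ioc 0 ((c : ℝ) - ((((PolyMP.panelCentre (c / (2 * m)) (m - 1) : ℚ) : ℝ) + ρ))),
        weilArchDensityG t * ((2 * g (((PolyMP.panelCentre (c / (2 * m)) (m - 1) : ℚ) : ℝ) + ρ) -
          g (((PolyMP.panelCentre (c / (2 * m)) (m - 1) : ℚ) : ℝ) + ρ - t) -
          g (((PolyMP.panelCentre (c / (2 * m)) (m - 1) : ℚ) : ℝ) + ρ + t)) / t))
      (dt_archEEdgeTM S c m Dl A0 W0 pw0) := by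
  have hmq : (0 : ℚ) < m := by exact_mod_cast hm
  have hh0 : 0 ≤ c / (2 * m) := by positivity
  unfold dt_archEEdgeTM
  refine tmem_wmom hS hh0 Dl has0 (by simp [dt_kappaE]) (fun j _ ↦ dt_tmem_movMom hS hc hm hW0 pw0 j) fun ρ hρ ↦ ?_
  rw [← has0.length_eq]
  exact dt_archEEdge_expand hc hm hexp0 hρ

/-- A chunk of rows `b₀ ≤ b < b₀ + n` of the E-part (kernel object, one `decide` each). -/
def dt_archEChunk (S : ℕ) (c : ℚ) (m Dl : ℕ) (A0 : IPoly) (W0 : IPoly) (pw0 : Poly) (b0 n : ℕ) : IPoly :=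
  wmomRangeTM S (c / (2 * m)) Dl A0 dt_kappaE (fun j ↦ dt_movMomTM S (c / (2 * m)) W0 pw0 j) b0 n

/-- **E on the edge panel from two row chunks** plus the crude tail beyond `b₁ = 1 + n₁ + n₂` (moments bounded by `M0`). -/
theorem dt_tmem_archEEdge_chunks (hS : 0 < S) (hc : 0 < c) (hm : 0 < m) (Dl : ℕ)
    {as0 : List ℝ} {A0 : IPoly} (has0 : PMem S as0 A0)
    (hexp0 : ∀ s, g (((PolyMP.panelCentre (c / (2 * m)) (m - 1) : ℚ) : ℝ) + s) = evalR as0 s)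
    {W0 : IPoly} (hW0 : TMem S (c / (2 * m)) (fun u ↦ weilArchDensityG (((PolyMP.panelCentre (c / (2 * m)) 0 : ℚ) : ℝ) + u)) W0)
    (pw0 : Poly) {M0 : List MI}
    (hM0 : ∀ j, j < M0.length →
      MI.mem S (∫ t in (0 : ℝ)..(2 * ((c / (2 * m) : ℚ) : ℝ)), weilArchDensityG t * t ^ j) (M0.getD j default))
    (hlenM : A0.length ≤ M0.length + 1) {n1 n2 : ℕ} (hn : 1 + n1 + n2 ≤ A0.length) {E1 E2 : IPoly}
    (hE1 : dt_archEChunk S c m Dl A0 W0 pw0 1 n1 = E1) (hE2 : dt_archEChunk S c m Dl A0 W0 pw0 (1 + n1) n2 = E2) :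
    TMem S (c / (2 * m)) (fun ρ ↦ ∫ t in Ioc 0 ((c : ℝ) - ((((PolyMP.panelCentre (c / (2 * m)) (m - 1) : ℚ) : ℝ) + ρ))),
        weilArchDensityG t * ((2 * g (((PolyMP.panelCentre (c / (2 * m)) (m - 1) : ℚ) : ℝ) + ρ) -
          g (((PolyMP.panelCentre (c / (2 * m)) (m - 1) : ℚ) : ℝ) + ρ - t) -
          g (((PolyMP.panelCentre (c / (2 * m)) (m - 1) : ℚ) : ℝ) + ρ + t)) / t))
      (widen0 (taddI E1 E2) ⌈wmomTailQ S (c / (2 * m)) A0 dt_kappaE (fun j ↦ (M0.getD j default).hi) (1 + n1 + n2) * S⌉) := by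
  have hmq : (0 : ℚ) < m := by exact_mod_cast hm
  have hh0 : 0 ≤ c / (2 * m) := by positivity
  subst hE1 hE2
  refine tmem_wmom_chunks hS hh0 has0 (by simp [dt_kappaE]) hn
    (tmem_wmomRange hS hh0 Dl has0 dt_kappaE 1 n1 fun j _ ↦ dt_tmem_movMom hS hc hm hW0 pw0 _)
    (tmem_wmomRange hS hh0 Dl has0 dt_kappaE (1 + n1) n2 fun j _ ↦ dt_tmem_movMom hS hc hm hW0 pw0 _)
    (fun ρ hρ ↦ dt_movMom_bounds hS hc hm hM0 hlenM hρ) fun ρ hρ ↦ ?_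
  rw [← has0.length_eq]
  exact dt_archEEdge_expand hc hm hexp0 hρ

end EdgeArch
end Summit.RiemannHypothesis.RiemannHypothesis.Theorems.EvenWinsBeyondArch

end
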